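/-
Origin: expansion seat `planner-pub-hodgecm-toy-g2-0`, handover #8 2026-08-18T07:01:34Z (`HOME/pub-hodgecm-toy-g2/lean/ToyG2/Objects2.lean`, md5 2b277885, 326 lines);
landed by the gen-7 packager in gate run 25 as `HodgeCM/Model/ToyG2/Objects2.lean` (verbatim).
-/
/-
Copyright (c) 2026. All rights reserved.
Released under Apache 2.0 license as described in the file LICENSE.
-/
import Mathlib
import Summits.HodgeConjecture.HodgeCM.Model.Toy.Objects
import Summits.HodgeConjecture.HodgeCM.Model.Toy.Model

/-!
# ToyG2.Objects2 — objects and morphisms of the generation-2 model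

The generation-2 universe (`HOME/pub-hodgecm-toy-g2/DESIGN.md` §7) reuses the generation-1 objects
(`HodgeCM.Toy.Obj`: `Shape`-indexed families of CM atoms, `H^k = ⋀^k L`) but its varieties are
`Shape`-indexed families of **leaves**, a leaf being either a CM atom or a **Picard block** (`PLeaf`:
a gen-1 object `O` — the `4·|Q|` atoms of one fake Picard modular surface — together with its trace
functional `ℓ : ⋀⁴ L(O) → ℚ`).  The underlying gen-1 object `X.toObj` is obtained by expanding the
leaves (`expand`, structurally recursive in the shape, so that `(X.prod Y).toObj = X.toObj.prod Y.toObj`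
holds by `rfl`).

Morphisms `A ⟶ B` are the gen-1 morphisms `A.toObj ⟶ B.toObj` (Hodge maps `L B → L A`) that are
**block-admissible** (`Adm`): on every Picard block of `B` the map is either zero or a trace-preserving
linear isomorphism onto a Picard block of `A`.  This is what makes the Gysin axiom M26 provable with
genuine traces (DESIGN.md §7, "GYSIN STRATEGY"); between block-free objects (all CM abelian varieties
and their products) every gen-1 morphism is admissible (`Hom₂.ofHom`), so the gen-1 witnesses of the
CM axioms transfer verbatim.

Contents: `PLeaf`, `Leaf`, `Obj₂` (`toObj`, `prod`, `dim`, `dim_prod`, `inclAt`), `Adm` (`Adm.id`,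
`Adm.comp`, `Adm.of_noPB`), `Hom₂` (`id`, `comp`, `fst`, `snd`, `lift`, `lift_comp_fst/snd`, `ofHom`),
`IsBlockFree` (all in namespace `HodgeCM.ToyG2.Obj₂`); `HodgeCM.ToyG2.cmObj₂`, `HodgeCM.ToyG2.pbObj`.
-/

namespace HodgeCM.ToyG2

open HodgeCM.Toy HodgeCM.Toy.CMPresentation
open Literature.AlgebraicGeometry.Motives
open exteriorPower

noncomputable section

/-! ### Leaves -/

/-- A **Picard block**: a gen-1 object (its atoms) with a trace functional on `⋀⁴`. -/
structure PLeaf : Type where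
  /-- the atoms of the block -/
  O : Obj
  /-- the trace `∫_P : H⁴ = ⋀⁴ L → ℚ` -/
  ℓ : (⋀[ℚ]^4 O.L) →ₗ[ℚ] ℚ

/-- A leaf: a CM atom or a Picard block. -/
inductive Leaf : Type
  | atom (a : Atom)
  | pb (p : PLeaf)

namespace Leaf

/-- the gen-1 object of a leaf -/
@[reducible] def obj : Leaf → Obj
  | atom a => ⟨.unit, fun _ => a, 0⟩
  | pb p => p.O

/-- "is a Picard block" -/
def IsPB : Leaf → Prop
  | atom _ => False
  | pb _ => True

/-- (Ported verbatim from the HodgeCMPerL package; no docstring in the source.) -/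
instance : DecidablePred IsPB := fun l =>
  match l with
  | atom _ => isFalse (fun h => h)
  | pb _ => isTrue trivial

/-- (Ported verbatim from the HodgeCMPerL package; no docstring in the source.) -/
@[simp] lemma isPB_atom (a : Atom) : ¬ (atom a).IsPB := fun h => h
/-- (Ported verbatim from the HodgeCMPerL package; no docstring in the source.) -/
@[simp] lemma isPB_pb (p : PLeaf) : (pb p).IsPB := trivial

/-- the dimension contributed by a leaf: `[F:ℚ]/2` for an atom, `2` for a Picard block -/
def pdim : Leaf → ℕ
  | atom a => Module.finrank ℚ a.F / 2
  | pb _ => 2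

/-- (Ported verbatim from the HodgeCMPerL package; no docstring in the source.) -/
@[simp] lemma pdim_pb (p : PLeaf) : (pb p).pdim = 2 := rfl

/-- the degree-4 trace of a leaf (`0` for an atom, `ℓ` for a block) -/
def trace4 : (l : Leaf) → ((⋀[ℚ]^4 l.obj.L) →ₗ[ℚ] ℚ)
  | atom _ => 0
  | pb p => p.ℓ

end Leaf

/-! ### Objects -/

/-- An object of the generation-2 universe: a `Shape`-indexed family of leaves. -/
structure Obj₂ : Type where
  s : Shape
  leaf : s.toType → Leaf

namespace Obj₂

/-- expansion of a family of leaves into a gen-1 object (structurally recursive in the shape) -/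
@[reducible] def expand : (s : Shape) → (s.toType → Leaf) → Obj
  | .empty, _ => ⟨.empty, fun e => e.elim, 0⟩
  | .unit, l => (l ()).obj
  | .sum a b, l => (expand a (fun u => l (Sum.inl u))).prod (expand b (fun u => l (Sum.inr u)))

variable (X Y Z : Obj₂)

/-- the underlying gen-1 object -/
@[reducible] def toObj : Obj := expand X.s X.leaf

/-- its `H¹`-lattice -/
abbrev L : Type := X.toObj.L

/-- product: concatenation of the leaf families -/
@[reducible] def prod : Obj₂ := ⟨X.s.sum Y.s, Shape.sumElim X.leaf Y.leaf⟩

/-- (Ported verbatim from the HodgeCMPerL package; no docstring in the source.) -/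
lemma toObj_prod : (X.prod Y).toObj = X.toObj.prod Y.toObj := rfl

/-- dimension: the sum of the leaf dimensions -/
def dim : ℕ := ∑ u, (X.leaf u).pdim

/-- (Ported verbatim from the HodgeCMPerL package; no docstring in the source.) -/
lemma dim_prod : (X.prod Y).dim = X.dim + Y.dim := by
  unfold dim
  exact Fintype.sum_sum_type _

/-- block-free objects ("abelian varieties") -/
def IsBlockFree : Prop := ∀ u, ¬ (X.leaf u).IsPB

/-- (Ported verbatim from the HodgeCMPerL package; no docstring in the source.) -/
lemma isBlockFree_prod {X Y : Obj₂} (hX : X.IsBlockFree) (hY : Y.IsBlockFree) : (X.prod Y).IsBlockFree := by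
  rintro (u | u)
  · exact hX u
  · exact hY u

/-- inclusion of the lattice of the leaf at position `u` into the lattice of the expansion -/
def incl : (s : Shape) → (l : s.toType → Leaf) → (u : s.toType) →
    ((l u).obj.L →ₗ[ℚ] (expand s l).L)
  | .empty, _, u => u.elim
  | .unit, _, _ => LinearMap.id
  | .sum a _, l, .inl u => (Obj.inlL _ _) ∘ₗ incl a (fun v => l (Sum.inl v)) u
  | .sum _ b, l, .inr u => (Obj.inrL _ _) ∘ₗ incl b (fun v => l (Sum.inr v)) u

/-- inclusion of the lattice of the leaf of `X` at `u` into `L X` -/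
abbrev inclAt (u : X.s.toType) : (X.leaf u).obj.L →ₗ[ℚ] X.L := incl X.s X.leaf u

/-- (Ported verbatim from the HodgeCMPerL package; no docstring in the source.) -/
lemma inclAt_prod_inl (u : X.s.toType) :
    (X.prod Y).inclAt (Sum.inl u) = (Obj.inlL X.toObj Y.toObj) ∘ₗ X.inclAt u := rfl

/-- (Ported verbatim from the HodgeCMPerL package; no docstring in the source.) -/
lemma inclAt_prod_inr (u : Y.s.toType) :
    (X.prod Y).inclAt (Sum.inr u) = (Obj.inrL X.toObj Y.toObj) ∘ₗ Y.inclAt u := rfl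

variable {X Y Z}

/-! ### Block-admissibility -/

/-- A lattice map `φ : L B → L A` (the `H¹`-pull-back of a would-be morphism `A ⟶ B`) is
**block-admissible** if on every Picard block of `B` it is either zero or a trace-preserving linear
isomorphism onto a Picard block of `A`. -/
def Adm (A B : Obj₂) (φ : B.L →ₗ[ℚ] A.L) : Prop :=
  ∀ u : B.s.toType, (B.leaf u).IsPB →
    φ ∘ₗ B.inclAt u = 0 ∨
    ∃ u' : A.s.toType, (A.leaf u').IsPB ∧
      ∃ g : (B.leaf u).obj.L ≃ₗ[ℚ] (A.leaf u').obj.L,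
        φ ∘ₗ B.inclAt u = A.inclAt u' ∘ₗ g.toLinearMap ∧
        (A.leaf u').trace4 ∘ₗ map 4 g.toLinearMap = (B.leaf u).trace4

namespace Adm

/-- (Ported verbatim from the HodgeCMPerL package; no docstring in the source.) -/
lemma id (A : Obj₂) : Adm A A LinearMap.id := by
  intro u hu
  refine Or.inr ⟨u, hu, LinearEquiv.refl ℚ _, ?_, ?_⟩
  · rw [LinearMap.id_comp, LinearEquiv.refl_toLinearMap, LinearMap.comp_id]
  · rw [LinearEquiv.refl_toLinearMap, map_id, LinearMap.comp_id]

/-- admissibility is closed under composition (`φ : L B → L A`, `ψ : L C → L B`) -/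
lemma comp {A B C : Obj₂} {φ : B.L →ₗ[ℚ] A.L} {ψ : C.L →ₗ[ℚ] B.L} (hφ : Adm A B φ)
    (hψ : Adm B C ψ) : Adm A C (φ ∘ₗ ψ) := by
  intro u hu
  rcases hψ u hu with h0 | ⟨u', hu', g₁, hg₁, ht₁⟩
  · left
    rw [LinearMap.comp_assoc, h0, LinearMap.comp_zero]
  · rcases hφ u' hu' with h0' | ⟨u'', hu'', g₂, hg₂, ht₂⟩
    · left
      rw [LinearMap.comp_assoc, hg₁, ← LinearMap.comp_assoc, h0', LinearMap.zero_comp]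
    · right
      refine ⟨u'', hu'', g₁.trans g₂, ?_, ?_⟩
      · rw [LinearMap.comp_assoc, hg₁, ← LinearMap.comp_assoc, hg₂, LinearMap.comp_assoc]
        rfl
      · rw [← ht₁, ← ht₂, LinearMap.comp_assoc]
        congr 1
        rw [← map_comp]
        rfl

/-- every map into a block-free object is admissible -/
lemma of_noPB {A B : Obj₂} (hB : B.IsBlockFree) (φ : B.L →ₗ[ℚ] A.L) : Adm A B φ :=
  fun u hu => absurd hu (hB u)

/-- (Ported verbatim from the HodgeCMPerL package; no docstring in the source.) -/
lemma zero (A B : Obj₂) : Adm A B 0 := fun _ _ => Or.inl (LinearMap.zero_comp _)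

end Adm

/-! ### Morphisms -/

variable (X Y Z)

/-- Morphisms `X ⟶ Y` of the generation-2 universe: block-admissible gen-1 morphisms. -/
structure Hom₂ : Type where
  /-- the underlying gen-1 morphism (a Hodge map `L Y → L X`) -/
  hom : Obj.Hom X.toObj Y.toObj
  adm : Adm X Y hom.lin

variable {X Y Z}

namespace Hom₂

/-- the lattice map -/
abbrev lin (f : Hom₂ X Y) : Y.L →ₗ[ℚ] X.L := f.hom.lin

/-- (Ported verbatim from the HodgeCMPerL package; no docstring in the source.) -/
@[ext] lemma ext {f g : Hom₂ X Y} (h : f.hom = g.hom) : f = g := by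
  cases f; cases g; congr

/-- identity -/
def id (X : Obj₂) : Hom₂ X X := ⟨Obj.Hom.id X.toObj, Adm.id X⟩

/-- composition in diagrammatic order -/
def comp (f : Hom₂ X Y) (g : Hom₂ Y Z) : Hom₂ X Z := ⟨f.hom.comp g.hom, f.adm.comp g.adm⟩

/-- (Ported verbatim from the HodgeCMPerL package; no docstring in the source.) -/
@[simp] lemma id_hom (X : Obj₂) : (Hom₂.id X).hom = Obj.Hom.id X.toObj := rfl
/-- (Ported verbatim from the HodgeCMPerL package; no docstring in the source.) -/
@[simp] lemma comp_hom (f : Hom₂ X Y) (g : Hom₂ Y Z) : (f.comp g).hom = f.hom.comp g.hom := rfl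

/-- a gen-1 morphism into a block-free object is a morphism -/
def ofHom (f : Obj.Hom X.toObj Y.toObj) (hY : Y.IsBlockFree) : Hom₂ X Y := ⟨f, Adm.of_noPB hY _⟩

/-- (Ported verbatim from the HodgeCMPerL package; no docstring in the source.) -/
@[simp] lemma ofHom_hom (f : Obj.Hom X.toObj Y.toObj) (hY : Y.IsBlockFree) :
    (ofHom f hY).hom = f := rfl

variable (X Y)

/-- first projection -/
def fst : Hom₂ (X.prod Y) X where
  hom := Obj.fst X.toObj Y.toObj
  adm := by
    intro u hu
    refine Or.inr ⟨Sum.inl u, hu, LinearEquiv.refl ℚ _, ?_, ?_⟩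
    · rw [LinearEquiv.refl_toLinearMap, LinearMap.comp_id]
      rfl
    · rw [LinearEquiv.refl_toLinearMap, map_id, LinearMap.comp_id]

/-- second projection -/
def snd : Hom₂ (X.prod Y) Y where
  hom := Obj.snd X.toObj Y.toObj
  adm := by
    intro u hu
    refine Or.inr ⟨Sum.inr u, hu, LinearEquiv.refl ℚ _, ?_, ?_⟩
    · rw [LinearEquiv.refl_toLinearMap, LinearMap.comp_id]
      rfl
    · rw [LinearEquiv.refl_toLinearMap, map_id, LinearMap.comp_id]

variable {X Y}

/-- (Ported verbatim from the HodgeCMPerL package; no docstring in the source.) -/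
@[simp] lemma fst_hom : (fst X Y).hom = Obj.fst X.toObj Y.toObj := rfl
/-- (Ported verbatim from the HodgeCMPerL package; no docstring in the source.) -/
@[simp] lemma snd_hom : (snd X Y).hom = Obj.snd X.toObj Y.toObj := rfl

/-- (Ported verbatim from the HodgeCMPerL package; no docstring in the source.) -/
lemma lift_lin_comp_inlL (f : Obj.Hom Z.toObj X.toObj) (g : Obj.Hom Z.toObj Y.toObj) :
    (Obj.lift f g).lin ∘ₗ Obj.inlL X.toObj Y.toObj = f.lin :=
  congrArg Obj.Hom.lin (Obj.lift_comp_fst f g)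

/-- (Ported verbatim from the HodgeCMPerL package; no docstring in the source.) -/
lemma lift_lin_comp_inrL (f : Obj.Hom Z.toObj X.toObj) (g : Obj.Hom Z.toObj Y.toObj) :
    (Obj.lift f g).lin ∘ₗ Obj.inrL X.toObj Y.toObj = g.lin :=
  congrArg Obj.Hom.lin (Obj.lift_comp_snd f g)

/-- the universal morphism into the product -/
def lift (f : Hom₂ Z X) (g : Hom₂ Z Y) : Hom₂ Z (X.prod Y) where
  hom := Obj.lift f.hom g.hom
  adm := by
    rintro (u | u) hu
    · have h : (Obj.lift f.hom g.hom).lin ∘ₗ (X.prod Y).inclAt (Sum.inl u)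
          = f.lin ∘ₗ X.inclAt u := by
        rw [inclAt_prod_inl, ← LinearMap.comp_assoc, lift_lin_comp_inlL]
      rcases f.adm u hu with h0 | ⟨u', hu', g', hg', ht'⟩
      · left
        rw [h, h0]
      · right
        exact ⟨u', hu', g', by rw [h, hg'], ht'⟩
    · have h : (Obj.lift f.hom g.hom).lin ∘ₗ (X.prod Y).inclAt (Sum.inr u)
          = g.lin ∘ₗ Y.inclAt u := by
        rw [inclAt_prod_inr, ← LinearMap.comp_assoc, lift_lin_comp_inrL]
      rcases g.adm u hu with h0 | ⟨u', hu', g', hg', ht'⟩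
      · left
        rw [h, h0]
      · right
        exact ⟨u', hu', g', by rw [h, hg'], ht'⟩

/-- (Ported verbatim from the HodgeCMPerL package; no docstring in the source.) -/
lemma lift_comp_fst (f : Hom₂ Z X) (g : Hom₂ Z Y) : (lift f g).comp (fst X Y) = f :=
  Hom₂.ext (Obj.lift_comp_fst f.hom g.hom)

/-- (Ported verbatim from the HodgeCMPerL package; no docstring in the source.) -/
lemma lift_comp_snd (f : Hom₂ Z X) (g : Hom₂ Z Y) : (lift f g).comp (snd X Y) = g :=
  Hom₂.ext (Obj.lift_comp_snd f.hom g.hom)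

end Hom₂

end Obj₂

/-! ### Special objects -/

open Obj₂

/-- the CM abelian variety `A_{(K,Φ)}`: one atom leaf (its gen-1 object is `cmObj K Φ` by `rfl`) -/
@[reducible] def cmObj₂ (K : CMField) (Φ : CMType K) : Obj₂ := ⟨.unit, fun _ => .atom (atomOf K Φ)⟩

/-- (Ported verbatim from the HodgeCMPerL package; no docstring in the source.) -/
lemma toObj_cmObj₂ (K : CMField) (Φ : CMType K) : (cmObj₂ K Φ).toObj = cmObj K Φ := rfl

/-- (Ported verbatim from the HodgeCMPerL package; no docstring in the source.) -/
lemma isBlockFree_cmObj₂ (K : CMField) (Φ : CMType K) : (cmObj₂ K Φ).IsBlockFree :=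
  fun _ h => h

/-- the object of one Picard block -/
@[reducible] def pbObj (p : PLeaf) : Obj₂ := ⟨.unit, fun _ => .pb p⟩

/-- (Ported verbatim from the HodgeCMPerL package; no docstring in the source.) -/
lemma toObj_pbObj (p : PLeaf) : (pbObj p).toObj = p.O := rfl

/-- (Ported verbatim from the HodgeCMPerL package; no docstring in the source.) -/
lemma dim_pbObj (p : PLeaf) : (pbObj p).dim = 2 := by
  simp [dim]

/-- (Ported verbatim from the HodgeCMPerL package; no docstring in the source.) -/
lemma dim_cmObj₂ (K : CMField) (Φ : CMType K) :
    (cmObj₂ K Φ).dim = Module.finrank ℚ K / 2 := by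
  simp [dim, Leaf.pdim, finrank_FK]

end

end HodgeCM.ToyG2
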